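import Literature.Barriers.ABC.SzpiroEpsilonCannotBeDroppedMasserProofs
import Literature.NumberTheory.EllipticCurves.SzpiroProofs

/-!
# Crux `TwistAmplification.SomeWindowSaving` (stmt-ABC-1976), line `polynomial-degree-suffices`:
# the exponent of weak (generalized) Szpiro must exceed `6`, already on semistable curves

Negative-side (drefute) TIGHTNESS lemmas for the lead's stub set (skeleton of 2026-08-16T01:09Z):

* `stub_zagierSilvermanBridgeSemistable` concludes, and `stub_semistableToAllSzpiro` assumes,
  `WGS_ss := ∃ K C, ∀ W₀/ℤ elliptic, minimal at all v, SEMISTABLE → max(|Δ|,|c₄|³) ≤ C·N^K`;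
  `stub_semistableToAllSzpiro` concludes the same without `IsSemistable` (`WGS_all`, which the standing
  disprover calibrated as equivalent to the crux).

We prove that no witness of either statement can have `K ≤ 6`:
`not_weakSzpiro_semistable_six`, `not_weakSzpiro_semistable_of_le_six`,
`weakSzpiro_semistable_exponent_gt_six` (any witness `(K, C)` of `WGS_ss` has `6 < K`) and the
all-curves corollary `weakSzpiro_exponent_gt_six`.  Source of the witnesses: Masser's semistable Frey
curves, PROVED in the tree in quantitative form
(`Literature.Barriers.ABC.Masser.exists_curve_quant`: `log|Δ_min| ≥ 6 log N + (12−η)·y/log y`,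
`N > y`, for all large `y`), transported to a global minimal model over `ℤ`
(`exists_variableChange_eq_baseChange_int`, `conductorNorm_smul_rat`,
`minimalDiscriminantNorm_smul_rat`, `minimalDiscriminantNorm_eq_natAbs_holds`,
`isSemistable_smul_iff_holds`).

Use for the line: the bridge (stub B) must OUTPUT an exponent `K > 6`, and the additive upgrade
(stub C) can only ever be fed exponents `K > 6`; the known transfer devices for C (power maps on abc
triples + Bombieri–Gubler 12.5.12 bookkeeping) work only for `K < 144/23 ≈ 6.26`
(drefute note `Cruxes/SomeWindowSaving/NegativeNote-stub_semistableToAllSzpiro.md`).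
-/

noncomputable section

open IsDedekindDomain WeierstrassCurve


namespace Summit.ABC.ABC.Theorems.SomeWindowSaving.Negative

/-- **Weak generalized Szpiro fails with exponent `6` on semistable curves** (Masser 1990): there is
no `C` with `max(|Δ(W₀)|, |c₄(W₀)|³) ≤ C · N⁶` for every global minimal integral model `W₀` of a
semistable elliptic curve over `ℚ`.  This is the `K = 6` instance of the antecedent of
`stub_semistableToAllSzpiro` / the conclusion of `stub_zagierSilvermanBridgeSemistable`. -/
theorem not_weakSzpiro_semistable_six :
    ¬ ∃ C : ℝ, ∀ W₀ : WeierstrassCurve ℤ, (W₀.baseChange ℚ).IsElliptic →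
      (∀ v : HeightOneSpectrum ℤ, (W₀.baseChange ℚ).IsMinimalAt v) →
        (W₀.baseChange ℚ).IsSemistable ℤ →
          ((max |W₀.Δ| (|W₀.c₄| ^ 3) : ℤ) : ℝ) ≤
            C * (((W₀.baseChange ℚ).conductorNorm ℤ : ℕ) : ℝ) ^ (6 : ℝ) := by
  rintro ⟨C, hC⟩
  -- Masser's semistable curves: `log|Δ_min| ≥ 6 log N + 11 y / log y`, `N > y`, all large `y`
  obtain ⟨y₀, hy₀⟩ :=
    Literature.Barriers.ABC.Masser.exists_curve_quant (η := 1) one_pos le_rfl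
  set C' : ℝ := max C 1 with hC'def
  have hC'1 : 1 ≤ C' := le_max_right _ _
  have hC'0 : 0 < C' := one_pos.trans_le hC'1
  have hCC' : C ≤ C' := le_max_left _ _
  have hlog0 : 0 ≤ Real.log C' := Real.log_nonneg hC'1
  -- choose `y ≥ y₀`, `y ≥ 4`, with `√y > log C'`
  set y : ℕ := max y₀ (max 4 (⌈Real.log C' ^ 2⌉₊ + 1)) with hydef
  have hyy₀ : y₀ ≤ y := le_max_left _ _
  have hy4 : 4 ≤ y := (le_max_left _ _).trans (le_max_right _ _)
  have hylog : Real.log C' < Real.sqrt y := by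
    have h1 : ⌈Real.log C' ^ 2⌉₊ + 1 ≤ y := (le_max_right _ _).trans (le_max_right _ _)
    have h1' : ((⌈Real.log C' ^ 2⌉₊ : ℕ) : ℝ) + 1 ≤ (y : ℝ) := by exact_mod_cast h1
    have h2 : Real.log C' ^ 2 < (y : ℝ) := by
      have := Nat.le_ceil (Real.log C' ^ 2)
      linarith
    calc Real.log C' = Real.sqrt (Real.log C' ^ 2) := (Real.sqrt_sq hlog0).symm
      _ < Real.sqrt y := Real.sqrt_lt_sqrt (sq_nonneg _) h2
  obtain ⟨W, hW, hss, hyN, -, hmain⟩ := hy₀ y hyy₀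
  haveI := hW
  -- pass to a global minimal model `W₀` over `ℤ`
  obtain ⟨D, W₀, hW₀, hmin⟩ :=
    Literature.NumberTheory.EllipticCurves.exists_variableChange_eq_baseChange_int W
  have hE : (W₀.baseChange ℚ).IsElliptic := hW₀ ▸ inferInstance
  have hss₀ : (W₀.baseChange ℚ).IsSemistable ℤ := by
    rw [← hW₀]; exact (WeierstrassCurve.isSemistable_smul_iff_holds ℤ W D).mpr hss
  have hN : (W₀.baseChange ℚ).conductorNorm ℤ = W.conductorNorm ℤ := by
    rw [← hW₀]; exact WeierstrassCurve.conductorNorm_smul_rat W D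
  have hΔ₀ : W₀.Δ ≠ 0 := by
    intro h0
    haveI := hE
    apply (W₀.baseChange ℚ).isUnit_Δ.ne_zero
    rw [WeierstrassCurve.baseChange, WeierstrassCurve.map_Δ, h0, map_zero]
  have hdisc : W.minimalDiscriminantNorm ℤ = W₀.Δ.natAbs := by
    rw [← WeierstrassCurve.minimalDiscriminantNorm_smul_rat W D, hW₀]
    exact WeierstrassCurve.minimalDiscriminantNorm_eq_natAbs_holds W₀ hΔ₀ hmin
  -- the assumed bound on `W₀`
  have key := hC W₀ hE hmin hss₀
  rw [hN] at key
  set N : ℝ := ((W.conductorNorm ℤ : ℕ) : ℝ) with hNdef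
  have hN1 : (1 : ℝ) ≤ N := by
    rw [hNdef]; exact_mod_cast (show 1 ≤ W.conductorNorm ℤ by omega)
  have hN0 : (0 : ℝ) < N := one_pos.trans_le hN1
  have hΔle : ((W₀.Δ.natAbs : ℕ) : ℝ) ≤ C' * N ^ (6 : ℝ) := by
    have h1 : ((W₀.Δ.natAbs : ℕ) : ℝ) = ((|W₀.Δ| : ℤ) : ℝ) := by
      rw [Nat.cast_natAbs, Int.cast_abs]
    have h2 : ((|W₀.Δ| : ℤ) : ℝ) ≤ ((max |W₀.Δ| (|W₀.c₄| ^ 3) : ℤ) : ℝ) := by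
      exact_mod_cast le_max_left _ _
    have h3 : C * N ^ (6 : ℝ) ≤ C' * N ^ (6 : ℝ) :=
      mul_le_mul_of_nonneg_right hCC' (Real.rpow_nonneg hN0.le _)
    rw [h1]; exact h2.trans (key.trans h3)
  -- logs: `log|Δ_min| ≤ log C' + 6 log N`
  have hD0 : (0 : ℝ) < ((W₀.Δ.natAbs : ℕ) : ℝ) := by exact_mod_cast Int.natAbs_pos.mpr hΔ₀
  have hlogΔ : Real.log ((W.minimalDiscriminantNorm ℤ : ℕ) : ℝ) ≤ Real.log C' + 6 * Real.log N := by
    rw [hdisc]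
    have := Real.log_le_log hD0 hΔle
    rw [Real.log_mul hC'0.ne' (Real.rpow_pos_of_pos hN0 _).ne', Real.log_rpow hN0] at this
    linarith
  -- Masser: `6 log N + 11 y / log y ≤ log|Δ_min|`, hence `11 y / log y ≤ log C'`
  have hyl : (12 - 1 : ℝ) * y / Real.log y ≤ Real.log C' := by linarith
  -- but `log y ≤ 2 √y`, so `11 y / log y ≥ (11/2) √y > log C'`
  have hy0 : (0 : ℝ) < y := by exact_mod_cast (show 0 < y by omega)
  have hy1 : (1 : ℝ) < y := by exact_mod_cast (show 1 < y by omega)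
  have hlogy0 : 0 < Real.log y := Real.log_pos hy1
  have hsqrt0 : 0 < Real.sqrt y := Real.sqrt_pos.mpr hy0
  have hlogy : Real.log y ≤ 2 * Real.sqrt y := by
    have h1 : Real.log (Real.sqrt y) ≤ Real.sqrt y - 1 := Real.log_le_sub_one_of_pos hsqrt0
    have h2 : Real.log y = 2 * Real.log (Real.sqrt y) := by
      rw [Real.log_sqrt hy0.le]; ring
    linarith
  have hysq : Real.sqrt y * Real.sqrt y = (y : ℝ) := Real.mul_self_sqrt hy0.le
  have hcontra : Real.log C' * Real.log y < (12 - 1 : ℝ) * y := by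
    have h1 : Real.log C' * Real.log y ≤ Real.sqrt y * (2 * Real.sqrt y) :=
      mul_le_mul hylog.le hlogy hlogy0.le hsqrt0.le
    nlinarith
  have hyl' : (12 - 1 : ℝ) * y ≤ Real.log C' * Real.log y := by
    rwa [div_le_iff₀ hlogy0] at hyl
  linarith

/-- Any exponent `K ≤ 6` fails as well (since `N ≥ 1`). -/
theorem not_weakSzpiro_semistable_of_le_six {K : ℝ} (hK : K ≤ 6) :
    ¬ ∃ C : ℝ, ∀ W₀ : WeierstrassCurve ℤ, (W₀.baseChange ℚ).IsElliptic →
      (∀ v : HeightOneSpectrum ℤ, (W₀.baseChange ℚ).IsMinimalAt v) →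
        (W₀.baseChange ℚ).IsSemistable ℤ →
          ((max |W₀.Δ| (|W₀.c₄| ^ 3) : ℤ) : ℝ) ≤
            C * (((W₀.baseChange ℚ).conductorNorm ℤ : ℕ) : ℝ) ^ K := by
  rintro ⟨C, hC⟩
  refine not_weakSzpiro_semistable_six ⟨max C 0, fun W₀ hE hmin hss ↦ ?_⟩
  haveI := hE
  have hN1 : (1 : ℝ) ≤ (((W₀.baseChange ℚ).conductorNorm ℤ : ℕ) : ℝ) := by
    exact_mod_cast WeierstrassCurve.conductorNorm_pos_holds (W₀.baseChange ℚ)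
  calc ((max |W₀.Δ| (|W₀.c₄| ^ 3) : ℤ) : ℝ)
      ≤ C * (((W₀.baseChange ℚ).conductorNorm ℤ : ℕ) : ℝ) ^ K := hC W₀ hE hmin hss
    _ ≤ max C 0 * (((W₀.baseChange ℚ).conductorNorm ℤ : ℕ) : ℝ) ^ K :=
        mul_le_mul_of_nonneg_right (le_max_left _ _) (Real.rpow_nonneg (by positivity) _)
    _ ≤ max C 0 * (((W₀.baseChange ℚ).conductorNorm ℤ : ℕ) : ℝ) ^ (6 : ℝ) :=
        mul_le_mul_of_nonneg_left (Real.rpow_le_rpow_of_exponent_le hN1 hK) (le_max_right _ _)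

/-- **Tightness of the stubs' seam.** Every witness `(K, C)` of the antecedent of
`stub_semistableToAllSzpiro` (= the conclusion of `stub_zagierSilvermanBridgeSemistable`) has
`6 < K`: whatever proof the bridge receives, it must output an exponent above Szpiro's `6`. -/
theorem weakSzpiro_semistable_exponent_gt_six {K C : ℝ}
    (h : ∀ W₀ : WeierstrassCurve ℤ, (W₀.baseChange ℚ).IsElliptic →
      (∀ v : HeightOneSpectrum ℤ, (W₀.baseChange ℚ).IsMinimalAt v) →
        (W₀.baseChange ℚ).IsSemistable ℤ →
          ((max |W₀.Δ| (|W₀.c₄| ^ 3) : ℤ) : ℝ) ≤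
            C * (((W₀.baseChange ℚ).conductorNorm ℤ : ℕ) : ℝ) ^ K) :
    6 < K := by
  by_contra hK
  exact not_weakSzpiro_semistable_of_le_six (not_lt.mp hK) ⟨C, h⟩

/-- The same for the all-curves statement (the conclusion of `stub_semistableToAllSzpiro`, i.e.
weak generalized Szpiro `WGS_all`, calibrated by the standing disprover as equivalent to the crux):
any witness `(K, C)` has `6 < K`. -/
theorem weakSzpiro_exponent_gt_six {K C : ℝ}
    (h : ∀ W₀ : WeierstrassCurve ℤ, (W₀.baseChange ℚ).IsElliptic →
      (∀ v : HeightOneSpectrum ℤ, (W₀.baseChange ℚ).IsMinimalAt v) →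
        ((max |W₀.Δ| (|W₀.c₄| ^ 3) : ℤ) : ℝ) ≤
          C * (((W₀.baseChange ℚ).conductorNorm ℤ : ℕ) : ℝ) ^ K) :
    6 < K :=
  weakSzpiro_semistable_exponent_gt_six (C := C) fun W₀ hE hmin _ ↦ h W₀ hE hmin

end Summit.ABC.ABC.Theorems.SomeWindowSaving.Negative

end
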